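import Summits.CriticalPhenomena.PercolationContinuityZ3.Theorems.Transplant.FKConnectivityAllQPat3CornerCone
import Summits.CriticalPhenomena.PercolationContinuityZ3.Theorems.Transplant.FKConnectivityAllQPat3FastCheck
import HarnessLib

/-!
# Connectivity correlation inequalities for `φ_{w,q}`, every `q > 0` — THEOREM SP DATA, CORNER placement: the certificate for `starXTab`
# (1 products, denominator 4; census g32's type-II law)

Theorems + data file (`--supports stmt-CriticalPhenomena-4575`), census lane `prim-bschramm-census` (gen 36) of the post-continuity programme (LANE 2 bschramm, FK sub-lane);
builds on p205010 (kernel theorem, internal audit signed; external expert review pending).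
No named facts, no sorries; standard axioms (`decide +kernel` only).  The type-II certificate of census g32 §4.1 for the target
`starXTab` re-derived by LP in ordered tables (`code/lp/corner.py`), embedded as three-generator products with the all-ones dummy
`FK.one2`, checked in 25 pair declarations and assembled into **`FK.cornerStar_level_nonneg`** by `FK.corner_level_nonneg_of_symCertG`.
[cite: AyyerLinussonRavichandran2025, §7 eq. (13)–(15) (p. 22)] [cite: Grimmett2006, §3.8 (pp. 61–62)]
-/

noncomputable section

namespace Summit.CriticalPhenomena.PercolationContinuityZ3.Theorems

namespace FK

open SimpleGraph Literature.Probability.LatticeModels Literature.Probability.Percolation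

section Data

/- Sequential elaboration of the kernel evaluations (memory on the smaller farm nodes). -/
set_option Elab.async false

open scoped Classical

variable {V : Type*} [Fintype V]

/-- The 1 two-generator products of the CORNER certificate for the target `starXTab` (denominator `4`, shifts `≤ 0`), found by
census g36's LP `code/lp/corner.py`: `⟨λ·D, κ, g_1, g_2⟩`. [folklore] -/
def prodsCornerStar : List Prod2G :=
  [
  ⟨1, 0, Gen.fam starXTab, Gen.fam starXTab⟩]

/-- The embedded three-generator products. [folklore] -/
abbrev prodsLCornerStar : List Prod3 := prodsCornerStar.map Prod2G.toProd3

/-- The symmetrised target function (CORNER join/correction, third pair ignored). [folklore] -/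
abbrev tauCornerStar : ℕ → Pat3 → Pat3 → Pat3 → Pat3 → Pat3 → Pat3 → ℤ := target3SymF joinC3 corrC3 starXTab

/-- Every generator passes its side condition. [folklore] -/
theorem cornerStar_ok : (prodsCornerStar.all Prod2G.ok) = true := by decide +kernel

/-- The shifts are at most `0`. [folklore] -/
theorem cornerStar_shift : ((prodsCornerStar.map Prod2G.toProd3).all fun p => decide (p.shift ≤ 0)) = true := by decide +kernel

/-- Pair `(all, all)` of the CornerStar certificate check (kernel evaluation). [folklore] -/
theorem cornerStar_pair_all_all : loop1G tauCornerStar 8 4 0 (prodsLCornerStar.filter fun p => suppAt p.gK Pat3.all Pat3.all) Pat3.all Pat3.all = true := by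
  decide +kernel

/-- Pair `(all, xy_s)` of the CornerStar certificate check (kernel evaluation). [folklore] -/
theorem cornerStar_pair_all_xy_s : loop1G tauCornerStar 8 4 0 (prodsLCornerStar.filter fun p => suppAt p.gK Pat3.all Pat3.xy_s) Pat3.all Pat3.xy_s = true := by
  decide +kernel

/-- Pair `(all, xs_y)` of the CornerStar certificate check (kernel evaluation). [folklore] -/
theorem cornerStar_pair_all_xs_y : loop1G tauCornerStar 8 4 0 (prodsLCornerStar.filter fun p => suppAt p.gK Pat3.all Pat3.xs_y) Pat3.all Pat3.xs_y = true := by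
  decide +kernel

/-- Pair `(all, ys_x)` of the CornerStar certificate check (kernel evaluation). [folklore] -/
theorem cornerStar_pair_all_ys_x : loop1G tauCornerStar 8 4 0 (prodsLCornerStar.filter fun p => suppAt p.gK Pat3.all Pat3.ys_x) Pat3.all Pat3.ys_x = true := by
  decide +kernel

/-- Pair `(all, sep)` of the CornerStar certificate check (kernel evaluation). [folklore] -/
theorem cornerStar_pair_all_sep : loop1G tauCornerStar 8 4 0 (prodsLCornerStar.filter fun p => suppAt p.gK Pat3.all Pat3.sep) Pat3.all Pat3.sep = true := by
  decide +kernel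

/-- Pair `(xy_s, all)` of the CornerStar certificate check (kernel evaluation). [folklore] -/
theorem cornerStar_pair_xy_s_all : loop1G tauCornerStar 8 4 0 (prodsLCornerStar.filter fun p => suppAt p.gK Pat3.xy_s Pat3.all) Pat3.xy_s Pat3.all = true := by
  decide +kernel

/-- Pair `(xy_s, xy_s)` of the CornerStar certificate check (kernel evaluation). [folklore] -/
theorem cornerStar_pair_xy_s_xy_s : loop1G tauCornerStar 8 4 0 (prodsLCornerStar.filter fun p => suppAt p.gK Pat3.xy_s Pat3.xy_s) Pat3.xy_s Pat3.xy_s = true := by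
  decide +kernel

/-- Pair `(xy_s, xs_y)` of the CornerStar certificate check (kernel evaluation). [folklore] -/
theorem cornerStar_pair_xy_s_xs_y : loop1G tauCornerStar 8 4 0 (prodsLCornerStar.filter fun p => suppAt p.gK Pat3.xy_s Pat3.xs_y) Pat3.xy_s Pat3.xs_y = true := by
  decide +kernel

/-- Pair `(xy_s, ys_x)` of the CornerStar certificate check (kernel evaluation). [folklore] -/
theorem cornerStar_pair_xy_s_ys_x : loop1G tauCornerStar 8 4 0 (prodsLCornerStar.filter fun p => suppAt p.gK Pat3.xy_s Pat3.ys_x) Pat3.xy_s Pat3.ys_x = true := by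
  decide +kernel

/-- Pair `(xy_s, sep)` of the CornerStar certificate check (kernel evaluation). [folklore] -/
theorem cornerStar_pair_xy_s_sep : loop1G tauCornerStar 8 4 0 (prodsLCornerStar.filter fun p => suppAt p.gK Pat3.xy_s Pat3.sep) Pat3.xy_s Pat3.sep = true := by
  decide +kernel

/-- Pair `(xs_y, all)` of the CornerStar certificate check (kernel evaluation). [folklore] -/
theorem cornerStar_pair_xs_y_all : loop1G tauCornerStar 8 4 0 (prodsLCornerStar.filter fun p => suppAt p.gK Pat3.xs_y Pat3.all) Pat3.xs_y Pat3.all = true := by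
  decide +kernel

/-- Pair `(xs_y, xy_s)` of the CornerStar certificate check (kernel evaluation). [folklore] -/
theorem cornerStar_pair_xs_y_xy_s : loop1G tauCornerStar 8 4 0 (prodsLCornerStar.filter fun p => suppAt p.gK Pat3.xs_y Pat3.xy_s) Pat3.xs_y Pat3.xy_s = true := by
  decide +kernel

/-- Pair `(xs_y, xs_y)` of the CornerStar certificate check (kernel evaluation). [folklore] -/
theorem cornerStar_pair_xs_y_xs_y : loop1G tauCornerStar 8 4 0 (prodsLCornerStar.filter fun p => suppAt p.gK Pat3.xs_y Pat3.xs_y) Pat3.xs_y Pat3.xs_y = true := by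
  decide +kernel

/-- Pair `(xs_y, ys_x)` of the CornerStar certificate check (kernel evaluation). [folklore] -/
theorem cornerStar_pair_xs_y_ys_x : loop1G tauCornerStar 8 4 0 (prodsLCornerStar.filter fun p => suppAt p.gK Pat3.xs_y Pat3.ys_x) Pat3.xs_y Pat3.ys_x = true := by
  decide +kernel

/-- Pair `(xs_y, sep)` of the CornerStar certificate check (kernel evaluation). [folklore] -/
theorem cornerStar_pair_xs_y_sep : loop1G tauCornerStar 8 4 0 (prodsLCornerStar.filter fun p => suppAt p.gK Pat3.xs_y Pat3.sep) Pat3.xs_y Pat3.sep = true := by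
  decide +kernel

/-- Pair `(ys_x, all)` of the CornerStar certificate check (kernel evaluation). [folklore] -/
theorem cornerStar_pair_ys_x_all : loop1G tauCornerStar 8 4 0 (prodsLCornerStar.filter fun p => suppAt p.gK Pat3.ys_x Pat3.all) Pat3.ys_x Pat3.all = true := by
  decide +kernel

/-- Pair `(ys_x, xy_s)` of the CornerStar certificate check (kernel evaluation). [folklore] -/
theorem cornerStar_pair_ys_x_xy_s : loop1G tauCornerStar 8 4 0 (prodsLCornerStar.filter fun p => suppAt p.gK Pat3.ys_x Pat3.xy_s) Pat3.ys_x Pat3.xy_s = true := by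
  decide +kernel

/-- Pair `(ys_x, xs_y)` of the CornerStar certificate check (kernel evaluation). [folklore] -/
theorem cornerStar_pair_ys_x_xs_y : loop1G tauCornerStar 8 4 0 (prodsLCornerStar.filter fun p => suppAt p.gK Pat3.ys_x Pat3.xs_y) Pat3.ys_x Pat3.xs_y = true := by
  decide +kernel

/-- Pair `(ys_x, ys_x)` of the CornerStar certificate check (kernel evaluation). [folklore] -/
theorem cornerStar_pair_ys_x_ys_x : loop1G tauCornerStar 8 4 0 (prodsLCornerStar.filter fun p => suppAt p.gK Pat3.ys_x Pat3.ys_x) Pat3.ys_x Pat3.ys_x = true := by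
  decide +kernel

/-- Pair `(ys_x, sep)` of the CornerStar certificate check (kernel evaluation). [folklore] -/
theorem cornerStar_pair_ys_x_sep : loop1G tauCornerStar 8 4 0 (prodsLCornerStar.filter fun p => suppAt p.gK Pat3.ys_x Pat3.sep) Pat3.ys_x Pat3.sep = true := by
  decide +kernel

/-- Pair `(sep, all)` of the CornerStar certificate check (kernel evaluation). [folklore] -/
theorem cornerStar_pair_sep_all : loop1G tauCornerStar 8 4 0 (prodsLCornerStar.filter fun p => suppAt p.gK Pat3.sep Pat3.all) Pat3.sep Pat3.all = true := by
  decide +kernel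

/-- Pair `(sep, xy_s)` of the CornerStar certificate check (kernel evaluation). [folklore] -/
theorem cornerStar_pair_sep_xy_s : loop1G tauCornerStar 8 4 0 (prodsLCornerStar.filter fun p => suppAt p.gK Pat3.sep Pat3.xy_s) Pat3.sep Pat3.xy_s = true := by
  decide +kernel

/-- Pair `(sep, xs_y)` of the CornerStar certificate check (kernel evaluation). [folklore] -/
theorem cornerStar_pair_sep_xs_y : loop1G tauCornerStar 8 4 0 (prodsLCornerStar.filter fun p => suppAt p.gK Pat3.sep Pat3.xs_y) Pat3.sep Pat3.xs_y = true := by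
  decide +kernel

/-- Pair `(sep, ys_x)` of the CornerStar certificate check (kernel evaluation). [folklore] -/
theorem cornerStar_pair_sep_ys_x : loop1G tauCornerStar 8 4 0 (prodsLCornerStar.filter fun p => suppAt p.gK Pat3.sep Pat3.ys_x) Pat3.sep Pat3.ys_x = true := by
  decide +kernel

/-- Pair `(sep, sep)` of the CornerStar certificate check (kernel evaluation). [folklore] -/
theorem cornerStar_pair_sep_sep : loop1G tauCornerStar 8 4 0 (prodsLCornerStar.filter fun p => suppAt p.gK Pat3.sep Pat3.sep) Pat3.sep Pat3.sep = true := by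
  decide +kernel

/-- **The symmetrised certificate family** for the embedded products. [folklore] -/
theorem cornerStar_cert (d : ℕ) (P1 Q1 P2 Q2 P3 Q3 : Pat3) :
    8 * ∑ j : Fin (prodsCornerStar.map Prod2G.toProd3).length,
        (((prodsCornerStar.map Prod2G.toProd3).get j).lam : ℤ) *
          ((prodsCornerStar.map Prod2G.toProd3).get j).tensor d P1 Q1 P2 Q2 P3 Q3 ≤
      (4 : ℕ) * target3Sym joinC3 corrC3 starXTab d P1 Q1 P2 Q2 P3 Q3 :=
  symCert_of_pairs corrC3_le_two 4 0 cornerStar_shift (fun PK QK => by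
    cases PK <;> cases QK
    exacts [cornerStar_pair_all_all, cornerStar_pair_all_xy_s, cornerStar_pair_all_xs_y, cornerStar_pair_all_ys_x, cornerStar_pair_all_sep,
      cornerStar_pair_xy_s_all, cornerStar_pair_xy_s_xy_s, cornerStar_pair_xy_s_xs_y, cornerStar_pair_xy_s_ys_x, cornerStar_pair_xy_s_sep,
      cornerStar_pair_xs_y_all, cornerStar_pair_xs_y_xy_s, cornerStar_pair_xs_y_xs_y, cornerStar_pair_xs_y_ys_x, cornerStar_pair_xs_y_sep,
      cornerStar_pair_ys_x_all, cornerStar_pair_ys_x_xy_s, cornerStar_pair_ys_x_xs_y, cornerStar_pair_ys_x_ys_x, cornerStar_pair_ys_x_sep,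
      cornerStar_pair_sep_all, cornerStar_pair_sep_xy_s, cornerStar_pair_sep_xs_y, cornerStar_pair_sep_ys_x, cornerStar_pair_sep_sep]) d P1 Q1 P2 Q2 P3 Q3

/-- **THEOREM SP, CORNER placement (target `starXTab`; census g32 type II, kernel):** for two two-terminal series–parallel pieces
`Q₁ ∋ s`, `Q₂ ∋ t` glued in parallel between `u ≠ v` (edge-disjoint; vertex supports meeting inside `{u, v}`; marks inner),
`0 ≤ 4 · lev2 (Q₁ ∪ Q₂) u s t starXTab λ` at every level `λ` — marks `(u, s, t)` with `u` the corner.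
[cite: AyyerLinussonRavichandran2025, §7 (p. 22)] -/
theorem cornerStar_level_nonneg {E₁ E₂ : Finset (Sym2 V)} {V₁ V₂ : Set V} {u v s t : V}
    (hd : Disjoint E₁ E₂) (h₁ : ∀ e ∈ (↑E₁ : Set (Sym2 V)), ∀ z ∈ e, z ∈ V₁)
    (h₂ : ∀ e ∈ (↑E₂ : Set (Sym2 V)), ∀ z ∈ e, z ∈ V₂) (h12 : V₁ ∩ V₂ ⊆ ({u, v} : Set V)) (huv : u ≠ v)
    (hs2 : s ∉ V₂) (ht1 : t ∉ V₁) (hsu : s ≠ u) (hsv : s ≠ v) (htu : t ≠ u) (htv : t ≠ v) (hst : s ≠ t)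
    (h1sp : IsTTSP E₁ u v) (h2sp : IsTTSP E₂ u v) (hs1 : ∃ e ∈ E₁, s ∈ e) (ht2 : ∃ e ∈ E₂, t ∈ e)
    (lam : ℕ) : 0 ≤ ((4 : ℕ) : ℤ) * lev2 (E₁ ∪ E₂) u s t starXTab lam :=
  corner_level_nonneg_of_symCertG hd h₁ h₂ h12 huv hs2 ht1 hsu hsv htu htv hst h1sp h2sp hs1 ht2 starXTab 4 prodsCornerStar
    cornerStar_ok cornerStar_cert lam

end Data

end FK

end Summit.CriticalPhenomena.PercolationContinuityZ3.Theorems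

end
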